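/-
Copyright (c) 2026. All rights reserved.
Released under Apache 2.0 license as described in the file LICENSE.
Authors: abc-iut cell, prover seat abc-iut-w5-d096 (gen 8; row «PUNCTURED-HIGHER-GENUS-IDRIGID», part 2:
the PRINT-FAITHFUL (RC-holomorphic) morphism class — twin of
`ArchimedeanHolFieldFunctorGeometricPSLPuncturedGenuine`).
-/
import Literature.AnabelianGeometry.AbsoluteAnabelian.ArchimedeanHolFieldFunctorGeometricPSLPuncturedGenuine
import Literature.AnabelianGeometry.AbsoluteAnabelian.ArchimedeanHolFieldFunctorGeometricRCPSLHfinFree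
import HarnessLib

/-!
# [AbsTopIII] Prop 4.2 (i) / Cor 4.5 at GENUINE punctured hyperbolic Riemann surfaces, print-faithful
# (RC-holomorphic) morphisms, over the cusp data (PROOF-ONLY)

S. Mochizuki, *Topics in Absolute Anabelian Geometry III*, proof of Prop 4.2 (i), kurims p.106 l.11–19;
Cor 4.5 pp.107–109; Def 4.1 (iii) p.103 with Cor 2.3 (i) p.53 (the morphisms of `EA` are the RC-holomorphic
finite étale maps — holomorphic AND anti-holomorphic; the tree's category `HolRS.RC`, interface datum
`HolRS.geometricAutHolFieldFunctorRC`).  Kurims manuscript `paper:url-5493eb38cbb7`; bib key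
`MochizukiAbsTopIII2015`.

Twin of `ArchimedeanHolFieldFunctorGeometricPSLPuncturedGenuine` (holomorphic morphisms) for print's own
morphism class, assembling BY NAME abc-iut-L4-t14's RC `hfin`-free column
(`RC.isIdRigid_EA_mapsTo_pslQuotient_of_isFreeOrSurface_hfinFree`, `RC.…_of_cusps_hfinFree` — same (P), (FC),
`hN` binders in the PSL currency), abc-iut-w6-d031's junction with its RC transport clause
(`exists_pslQuotient_iso_of_cover_transport`: «maps to `toRC (ℍ/Λ̄)`» = «maps to `toRC X`») and
puncture-is-cusp theorem, and part 1's `HolRS.exists_parabolic_mem_of_cover_of_isOfFiniteType`: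

* `HolRS.RC.isIdRigid_EA_and_cor_4_5_full_mapsTo_of_cover_of_hN` / `…_of_cover_of_cusps` — given a
  holomorphic covering `k : ℍ → X`, `π₁(X, x₀)` free-or-surface and non-abelian, and `hN` (resp. (P)+(FC))
  for the Möbius deck group of `k`: the geometric `EA` of «objects of `RC` mapping to `toRC X`» is ID-RIGID and
  `Cor_4_5_full` holds for its archimedean log-Frobenius data;
* `HolRS.RC.isIdRigid_EA_and_cor_4_5_full_mapsTo_of_isFreeOrSurface_fundamentalGroup_of_cusps` — no covering
  given (`X` second countable; uniformisation from part 1's inputs);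
* ★ `HolRS.RC.isIdRigid_EA_and_cor_4_5_full_ofOpens_compl_finite_of_cuspClasses` — the GENUINE `M ∖ S`,
  (P) DISCHARGED, hypotheses {`π₁` free-or-surface, non-abelian, (FC)};
* ★★ `HolRS.RC.isIdRigid_EA_and_cor_4_5_full_mapsTo_of_isOfFiniteType_of_cuspClasses` — EVERY non-compact
  connected second-countable Riemann surface OF FINITE TYPE, hypotheses {`π₁` free-or-surface, non-abelian,
  (FC)}.

Everything is a theorem; no definition, no instance, no named fact.  INPUTS THAT REMAIN (as in part 1):
(α) `IsFreeOrSurface (π₁(X, x₀))` — a topological INPUT for punctured genus `≥ 2` (like the compact column's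
`IsOrientableSurfaceGroup`); (β) `hFC` — to be consumed BY NAME from abc-iut-w6-d031's row «FC-ROUTE»
theorem when it lands.  HONEST FRAMING: classical; MODEL side of [AbsTopIII] §4 (model ≠ reconstruction ≠
node; NODES `AbsTopIII:Prop4.2(i)` / `AbsTopIII:Cor4.5` geometric column, support library); nothing here bears
on the disputed [IUTchIII] Cor. 3.12.

## References

* S. Mochizuki, *Topics in Absolute Anabelian Geometry III* (2015), proof of Prop. 4.2 (i) p.106,
  Cor. 4.5 pp.107–109, Def. 4.1 (iii) p.103, Cor. 2.3 (i) p.53. [MochizukiAbsTopIII2015]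
* H. M. Farkas, I. Kra, *Riemann Surfaces*, 2nd ed. (1992), IV.5.5–IV.5.6, IV.6. [FarkasKra1992]
-/

set_option autoImplicit false

noncomputable section

namespace Literature.AnabelianGeometry.AbsoluteAnabelian

namespace HolRS

open scoped _root_.Manifold _root_.ContDiff _root_.Topology UpperHalfPlane MatrixGroups Matrix
open _root_.MulAction _root_.Function _root_.CategoryTheory _root_.TopologicalSpace
open Literature.IUT.HodgeTheaters (IsFreeOrSurface)

/-! ### §1 A given holomorphic covering `k : ℍ → X` -/

section Cover

variable (X : HolRS)

/-- **Prop 4.2 (i) id-rigidity and `Cor_4_5_full` for PRINT-FAITHFUL morphisms at a genuine `X`, from `hN`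
for the Möbius deck group.**  For `X ∈ HolRS`, a holomorphic covering `k : ℍ → X`, `π₁(X, x₀)` free of finite
rank or an orientable surface group and non-abelian, and `[N_{PSL₂(ℝ)}(Λ̄′) : Λ̄′] < ∞` for every finite-index
subgroup `Λ̄′` of the Möbius deck group `Λ̄` of `k` (membership criterion): the geometric `EA` of «objects of
`RC` mapping to `toRC X`» is id-rigid and every printed clause of Cor 4.5 holds for its archimedean
log-Frobenius data (abc-iut-L4-t14's `RC.isIdRigid_EA_mapsTo_pslQuotient_of_isFreeOrSurface_hfinFree`,
`RC.cor_4_5_geometric_…`, transported along the junction's RC clause).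
[cite: MochizukiAbsTopIII2015, Proposition 4.2 (i) proof p.106]
[cite: MochizukiAbsTopIII2015, Corollary 4.5 pp.107–109] [cite: FarkasKra1992, IV.5.5–IV.5.6] -/
theorem RC.isIdRigid_EA_and_cor_4_5_full_mapsTo_of_cover_of_hN {k : ℍ → X.carrier} (hk : IsCoveringMap k)
    (dk : MDifferentiable 𝓘(ℂ, ℂ) 𝓘(ℂ, ℂ) k) (x₀ : X.carrier)
    (hπ : IsFreeOrSurface (FundamentalGroup X.carrier x₀))
    (hab : ∃ a b : FundamentalGroup X.carrier x₀, a * b ≠ b * a)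
    (hN : ∀ Λ : Subgroup PSL2R, (∀ q : PSL2R, q ∈ Λ ↔ ∀ τ : ℍ, k (q • τ) = k τ) →
      ∀ Λ' : _root_.Literature.AnabelianGeometry.AbsoluteAnabelian.LocObj Λ,
        (Λ'.toSubgroup.subgroupOf (Subgroup.normalizer (Λ'.toSubgroup : Set PSL2R))).FiniteIndex) :
    IsIdRigid (geometricAutHolFieldFunctorRC fun Y : RC => Nonempty (Y ⟶ toRC.obj X)).EA ∧
      AbsTopIII.Cor_4_5_full
        (archLogFrobeniusData (geometricAutHolFieldFunctorRC fun Y : RC => Nonempty (Y ⟶ toRC.obj X)))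
        (archTelecoreData (geometricAutHolFieldFunctorRC fun Y : RC => Nonempty (Y ⟶ toRC.obj X))) := by
  obtain ⟨Λ, hPD, hC, hΛ, hπΛ, -, -, hH⟩ := exists_pslQuotient_iso_of_cover_transport X hk dk
  obtain ⟨φ⟩ := hπΛ x₀
  have hΓ : IsFreeOrSurface Λ := IsFreeOrSurface.of_mulEquiv φ.symm hπ
  have habΛ : ∃ a b : Λ, a * b ≠ b * a := by
    obtain ⟨a, b, h⟩ := hab
    refine ⟨φ a, φ b, fun h' => h (φ.injective ?_)⟩
    rw [map_mul, map_mul]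
    exact h'
  have hE := RC.isIdRigid_EA_mapsTo_pslQuotient_of_isFreeOrSurface_hfinFree Λ hΓ habΛ (hN Λ hΛ)
  have hC45 := RC.cor_4_5_geometric_mapsTo_pslQuotient_of_isFreeOrSurface_hfinFree Λ hΓ habΛ (hN Λ hΛ)
  rw [hH] at hE hC45
  exact ⟨hE, (AbsTopIII.cor_4_5_full_arch_iff_cor_4_5 _).mpr hC45⟩

/-- **Prop 4.2 (i) id-rigidity and `Cor_4_5_full` for PRINT-FAITHFUL morphisms at a genuine PUNCTURED `X`,
from the cusp data (P)+(FC) of the Möbius deck group of `k`** (binder shapes of abc-iut-L4-t14's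
`RC.isIdRigid_EA_mapsTo_pslQuotient_of_cusps_hfinFree` VERBATIM; `hN` by abc-iut-L4-d1).
[cite: MochizukiAbsTopIII2015, Proposition 4.2 (i) proof p.106]
[cite: MochizukiAbsTopIII2015, Corollary 4.5 pp.107–109] [cite: FarkasKra1992, IV.5.6] -/
theorem RC.isIdRigid_EA_and_cor_4_5_full_mapsTo_of_cover_of_cusps {k : ℍ → X.carrier}
    (hk : IsCoveringMap k) (dk : MDifferentiable 𝓘(ℂ, ℂ) 𝓘(ℂ, ℂ) k) (x₀ : X.carrier)
    (hπ : IsFreeOrSurface (FundamentalGroup X.carrier x₀))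
    (hab : ∃ a b : FundamentalGroup X.carrier x₀, a * b ≠ b * a)
    (hP : ∀ Λ : Subgroup PSL2R, (∀ q : PSL2R, q ∈ Λ ↔ ∀ τ : ℍ, k (q • τ) = k τ) →
      ∃ t : SL(2, ℝ), QuotientGroup.mk' (Subgroup.center SL(2, ℝ)) t ∈ Λ ∧
        (t : Matrix (Fin 2) (Fin 2) ℝ).IsParabolic)
    (hFC : ∀ Λ : Subgroup PSL2R, (∀ q : PSL2R, q ∈ Λ ↔ ∀ τ : ℍ, k (q • τ) = k τ) →
      ∃ F : Finset (Fin 2 → ℝ), ∀ t : SL(2, ℝ),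
        QuotientGroup.mk' (Subgroup.center SL(2, ℝ)) t ∈ Λ → (t : Matrix (Fin 2) (Fin 2) ℝ).IsParabolic →
        ∀ v : Fin 2 → ℝ, v ≠ 0 → (∃ c : ℝ, (t : Matrix (Fin 2) (Fin 2) ℝ) *ᵥ v = c • v) →
        ∃ g : SL(2, ℝ), QuotientGroup.mk' (Subgroup.center SL(2, ℝ)) g ∈ Λ ∧ ∃ w ∈ F, ∃ c : ℝ,
          (g : Matrix (Fin 2) (Fin 2) ℝ) *ᵥ v = c • w) :
    IsIdRigid (geometricAutHolFieldFunctorRC fun Y : RC => Nonempty (Y ⟶ toRC.obj X)).EA ∧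
      AbsTopIII.Cor_4_5_full
        (archLogFrobeniusData (geometricAutHolFieldFunctorRC fun Y : RC => Nonempty (Y ⟶ toRC.obj X)))
        (archTelecoreData (geometricAutHolFieldFunctorRC fun Y : RC => Nonempty (Y ⟶ toRC.obj X))) := by
  obtain ⟨Λ, hPD, hC, hΛ, hπΛ, -, -, hH⟩ := exists_pslQuotient_iso_of_cover_transport X hk dk
  obtain ⟨φ⟩ := hπΛ x₀
  have hΓ : IsFreeOrSurface Λ := IsFreeOrSurface.of_mulEquiv φ.symm hπ
  have habΛ : ∃ a b : Λ, a * b ≠ b * a := by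
    obtain ⟨a, b, h⟩ := hab
    refine ⟨φ a, φ b, fun h' => h (φ.injective ?_)⟩
    rw [map_mul, map_mul]
    exact h'
  have hE := RC.isIdRigid_EA_mapsTo_pslQuotient_of_cusps_hfinFree Λ hΓ habΛ (hP Λ hΛ) (hFC Λ hΛ)
  have hC45 := RC.cor_4_5_geometric_mapsTo_pslQuotient_of_cusps_hfinFree Λ hΓ habΛ (hP Λ hΛ) (hFC Λ hΛ)
  rw [hH] at hE hC45
  exact ⟨hE, (AbsTopIII.cor_4_5_full_arch_iff_cor_4_5 _).mpr hC45⟩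

end Cover

/-! ### §2 No covering given -/

section Uniformised

variable (X : HolRS)

/-- **Print-faithful morphisms, no covering given**: `X` second countable, `π₁(X, x₀)` free-or-surface and
non-abelian, (P)+(FC) for the Möbius deck group of every holomorphic covering `ℍ → X` (the covering comes from
`exists_pslQuotient_iso_of_nonabelian_fundamentalGroup_unconditional`).
[cite: MochizukiAbsTopIII2015, Proposition 4.2 (i) proof p.106]
[cite: MochizukiAbsTopIII2015, Corollary 4.5 pp.107–109] [cite: FarkasKra1992, IV.5.5–IV.5.6] -/
theorem RC.isIdRigid_EA_and_cor_4_5_full_mapsTo_of_isFreeOrSurface_fundamentalGroup_of_cusps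
    [SecondCountableTopology X.carrier] (x₀ : X.carrier)
    (hπ : IsFreeOrSurface (FundamentalGroup X.carrier x₀))
    (hab : ∃ a b : FundamentalGroup X.carrier x₀, a * b ≠ b * a)
    (hP : ∀ k : ℍ → X.carrier, IsCoveringMap k → MDifferentiable 𝓘(ℂ, ℂ) 𝓘(ℂ, ℂ) k →
      ∀ Λ : Subgroup PSL2R, (∀ q : PSL2R, q ∈ Λ ↔ ∀ τ : ℍ, k (q • τ) = k τ) →
      ∃ t : SL(2, ℝ), QuotientGroup.mk' (Subgroup.center SL(2, ℝ)) t ∈ Λ ∧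
        (t : Matrix (Fin 2) (Fin 2) ℝ).IsParabolic)
    (hFC : ∀ k : ℍ → X.carrier, IsCoveringMap k → MDifferentiable 𝓘(ℂ, ℂ) 𝓘(ℂ, ℂ) k →
      ∀ Λ : Subgroup PSL2R, (∀ q : PSL2R, q ∈ Λ ↔ ∀ τ : ℍ, k (q • τ) = k τ) →
      ∃ F : Finset (Fin 2 → ℝ), ∀ t : SL(2, ℝ),
        QuotientGroup.mk' (Subgroup.center SL(2, ℝ)) t ∈ Λ → (t : Matrix (Fin 2) (Fin 2) ℝ).IsParabolic →
        ∀ v : Fin 2 → ℝ, v ≠ 0 → (∃ c : ℝ, (t : Matrix (Fin 2) (Fin 2) ℝ) *ᵥ v = c • v) →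
        ∃ g : SL(2, ℝ), QuotientGroup.mk' (Subgroup.center SL(2, ℝ)) g ∈ Λ ∧ ∃ w ∈ F, ∃ c : ℝ,
          (g : Matrix (Fin 2) (Fin 2) ℝ) *ᵥ v = c • w) :
    IsIdRigid (geometricAutHolFieldFunctorRC fun Y : RC => Nonempty (Y ⟶ toRC.obj X)).EA ∧
      AbsTopIII.Cor_4_5_full
        (archLogFrobeniusData (geometricAutHolFieldFunctorRC fun Y : RC => Nonempty (Y ⟶ toRC.obj X)))
        (archTelecoreData (geometricAutHolFieldFunctorRC fun Y : RC => Nonempty (Y ⟶ toRC.obj X))) := by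
  obtain ⟨k, Λ, hPD, hC, hk, dk, -⟩ :=
    exists_pslQuotient_iso_of_nonabelian_fundamentalGroup_unconditional X x₀ hab
  exact RC.isIdRigid_EA_and_cor_4_5_full_mapsTo_of_cover_of_cusps X hk dk x₀ hπ hab (hP k hk dk)
    (hFC k hk dk)

end Uniformised

/-! ### §3 The genuine `M ∖ S` and every non-compact finite-type surface: (P) discharged -/

section Punctured

variable {M : Type} [TopologicalSpace M] [T2Space M] [SecondCountableTopology M] [ChartedSpace ℂ M]
  [IsManifold 𝓘(ℂ, ℂ) ω M]

/-- ★ **[AbsTopIII] Prop 4.2 (i) id-rigidity and `Cor_4_5_full`, PRINT-FAITHFUL morphisms, at the GENUINE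
punctured Riemann surface `M ∖ S`, over (FC)** (`M` second countable, `S` finite non-empty, `M ∖ S`
connected, `π₁` free-or-surface and non-abelian); (P) by abc-iut-w6-d031's
`exists_parabolic_mem_of_cover_ofOpens_compl_finite`. [cite: MochizukiAbsTopIII2015, Proposition 4.2 (i) proof p.106]
[cite: MochizukiAbsTopIII2015, Corollary 4.5 pp.107–109] [cite: FarkasKra1992, IV.5.5–IV.5.6] -/
theorem RC.isIdRigid_EA_and_cor_4_5_full_ofOpens_compl_finite_of_cuspClasses {S : Set M}
    (hS : S.Finite) (hne : S.Nonempty) (hconn : IsConnected (Sᶜ : Set M))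
    (x₀ : (ofOpens (⟨Sᶜ, hS.isClosed.isOpen_compl⟩ : Opens M) hconn).carrier)
    (hπ : IsFreeOrSurface
      (FundamentalGroup (ofOpens (⟨Sᶜ, hS.isClosed.isOpen_compl⟩ : Opens M) hconn).carrier x₀))
    (hab : ∃ a b : FundamentalGroup (ofOpens (⟨Sᶜ, hS.isClosed.isOpen_compl⟩ : Opens M) hconn).carrier x₀,
      a * b ≠ b * a)
    (hFC : ∀ k : ℍ → (ofOpens (⟨Sᶜ, hS.isClosed.isOpen_compl⟩ : Opens M) hconn).carrier,
      IsCoveringMap k → MDifferentiable 𝓘(ℂ, ℂ) 𝓘(ℂ, ℂ) k →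
      ∀ Λ : Subgroup PSL2R, (∀ q : PSL2R, q ∈ Λ ↔ ∀ τ : ℍ, k (q • τ) = k τ) →
      ∃ F : Finset (Fin 2 → ℝ), ∀ t : SL(2, ℝ),
        QuotientGroup.mk' (Subgroup.center SL(2, ℝ)) t ∈ Λ → (t : Matrix (Fin 2) (Fin 2) ℝ).IsParabolic →
        ∀ v : Fin 2 → ℝ, v ≠ 0 → (∃ c : ℝ, (t : Matrix (Fin 2) (Fin 2) ℝ) *ᵥ v = c • v) →
        ∃ g : SL(2, ℝ), QuotientGroup.mk' (Subgroup.center SL(2, ℝ)) g ∈ Λ ∧ ∃ w ∈ F, ∃ c : ℝ,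
          (g : Matrix (Fin 2) (Fin 2) ℝ) *ᵥ v = c • w) :
    IsIdRigid (geometricAutHolFieldFunctorRC fun Y : RC =>
        Nonempty (Y ⟶ toRC.obj (ofOpens (⟨Sᶜ, hS.isClosed.isOpen_compl⟩ : Opens M) hconn))).EA ∧
      AbsTopIII.Cor_4_5_full
        (archLogFrobeniusData (geometricAutHolFieldFunctorRC fun Y : RC =>
          Nonempty (Y ⟶ toRC.obj (ofOpens (⟨Sᶜ, hS.isClosed.isOpen_compl⟩ : Opens M) hconn))))
        (archTelecoreData (geometricAutHolFieldFunctorRC fun Y : RC =>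
          Nonempty (Y ⟶ toRC.obj (ofOpens (⟨Sᶜ, hS.isClosed.isOpen_compl⟩ : Opens M) hconn)))) := by
  haveI : SecondCountableTopology
      (ofOpens (⟨Sᶜ, hS.isClosed.isOpen_compl⟩ : Opens M) hconn).carrier := by
    change SecondCountableTopology ((⟨Sᶜ, hS.isClosed.isOpen_compl⟩ : Opens M) : Type)
    infer_instance
  obtain ⟨k, Λ₀, hPD₀, hC₀, hk, dk, -⟩ :=
    exists_pslQuotient_iso_of_nonabelian_fundamentalGroup_unconditional _ x₀ hab
  refine RC.isIdRigid_EA_and_cor_4_5_full_mapsTo_of_cover_of_cusps (ofOpens (⟨Sᶜ, hS.isClosed.isOpen_compl⟩ :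
    Opens M) hconn) hk dk x₀ hπ hab ?_ (hFC k hk dk)
  intro Λ hΛ
  obtain ⟨Λ₁, hPD₁, hC₁, hΛ₁, -⟩ := exists_pslQuotient_iso_of_cover_transport _ hk dk
  have hΛeq : Λ = Λ₁ := by
    ext q
    rw [hΛ q, hΛ₁ q]
  subst hΛeq
  exact exists_parabolic_mem_of_cover_ofOpens_compl_finite hS hne hconn hk dk Λ hΛ

end Punctured

section FiniteType

variable (X : HolRS)

/-- ★★ **[AbsTopIII] Prop 4.2 (i) id-rigidity and `Cor_4_5_full`, PRINT-FAITHFUL morphisms, at EVERY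
non-compact connected second-countable Riemann surface OF FINITE TYPE** (`IsOfFiniteType`, the standing
hypothesis of Cor 2.4) with `π₁` free-or-surface and non-abelian, over (FC); (P) by part 1's
`HolRS.exists_parabolic_mem_of_cover_of_isOfFiniteType`. [cite: MochizukiAbsTopIII2015, Proposition 4.2 (i) proof p.106]
[cite: MochizukiAbsTopIII2015, Corollary 4.5 pp.107–109] [cite: FarkasKra1992, IV.5.5–IV.5.6] -/
theorem RC.isIdRigid_EA_and_cor_4_5_full_mapsTo_of_isOfFiniteType_of_cuspClasses
    [SecondCountableTopology X.carrier] (hX : IsOfFiniteType X.carrier) (hnc : ¬ CompactSpace X.carrier)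
    (x₀ : X.carrier) (hπ : IsFreeOrSurface (FundamentalGroup X.carrier x₀))
    (hab : ∃ a b : FundamentalGroup X.carrier x₀, a * b ≠ b * a)
    (hFC : ∀ k : ℍ → X.carrier, IsCoveringMap k → MDifferentiable 𝓘(ℂ, ℂ) 𝓘(ℂ, ℂ) k →
      ∀ Λ : Subgroup PSL2R, (∀ q : PSL2R, q ∈ Λ ↔ ∀ τ : ℍ, k (q • τ) = k τ) →
      ∃ F : Finset (Fin 2 → ℝ), ∀ t : SL(2, ℝ),
        QuotientGroup.mk' (Subgroup.center SL(2, ℝ)) t ∈ Λ → (t : Matrix (Fin 2) (Fin 2) ℝ).IsParabolic →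
        ∀ v : Fin 2 → ℝ, v ≠ 0 → (∃ c : ℝ, (t : Matrix (Fin 2) (Fin 2) ℝ) *ᵥ v = c • v) →
        ∃ g : SL(2, ℝ), QuotientGroup.mk' (Subgroup.center SL(2, ℝ)) g ∈ Λ ∧ ∃ w ∈ F, ∃ c : ℝ,
          (g : Matrix (Fin 2) (Fin 2) ℝ) *ᵥ v = c • w) :
    IsIdRigid (geometricAutHolFieldFunctorRC fun Y : RC => Nonempty (Y ⟶ toRC.obj X)).EA ∧
      AbsTopIII.Cor_4_5_full
        (archLogFrobeniusData (geometricAutHolFieldFunctorRC fun Y : RC => Nonempty (Y ⟶ toRC.obj X)))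
        (archTelecoreData (geometricAutHolFieldFunctorRC fun Y : RC => Nonempty (Y ⟶ toRC.obj X))) := by
  obtain ⟨k, Λ₀, hPD₀, hC₀, hk, dk, -⟩ :=
    exists_pslQuotient_iso_of_nonabelian_fundamentalGroup_unconditional X x₀ hab
  refine RC.isIdRigid_EA_and_cor_4_5_full_mapsTo_of_cover_of_cusps X hk dk x₀ hπ hab ?_ (hFC k hk dk)
  intro Λ hΛ
  obtain ⟨Λ₁, hPD₁, hC₁, hΛ₁, -⟩ := exists_pslQuotient_iso_of_cover_transport X hk dk
  have hΛeq : Λ = Λ₁ := by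
    ext q
    rw [hΛ q, hΛ₁ q]
  subst hΛeq
  exact X.exists_parabolic_mem_of_cover_of_isOfFiniteType hX hnc hk dk Λ hΛ

end FiniteType

end HolRS

end Literature.AnabelianGeometry.AbsoluteAnabelian

end
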